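import Summits.PneNP.PneNP.Theses.KarlinRubin
import Summits.PneNP.PneNP.Theorems.ConvexRankGatesCliqueBridgeTerm

/-!
# Route `KarlinRubin` · support item `CliqueCircuitsOfNotPneNP` (stmt-PneNP-18051)

The bridge hypothesis of the deciding theorem
`Summit.PneNP.PneNP.Theses.KarlinRubin.closes`: if `¬ PneNP` (i.e. `P = NP` in Cook's sense) then
there is an exponent `c` such that, for all large `n` and every `t ≤ n`, the clique function
`CLIQUE(n, t)` of the `n(n-1)/2` edge indicators has a `B₂`-circuit with at most `n ^ c` gates.

The proof is the composition of two theorems already landed in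
`Summits/PneNP/PneNP/Theorems/ConvexRankGatesCliqueBridgeTerm.lean`:

* `Summit.PneNP.PneNP.Theorems.NP_subset_PPoly_of_not_pneNP : ¬ PneNP → NP ⊆ P/poly`
  (Karp–Lipton's trivial direction `P ⊆ P/poly`, [AroraBarak2009, Thm. 6.6]);
* `Summit.PneNP.PneNP.Theorems.exists_circuit_cliqueFn_of_NP_subset_PPoly : NP ⊆ P/poly →`
  polynomial `B₂`-circuits for `cliqueFn n t`, uniformly in `t ≤ n` (`CLIQUE ∈ NP`, [Karp1972, §4]).

The route decl writes the clique function inline; it is definitionally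
`Literature.Computability.Complexity.cliqueFn n t`, so the composition closes the item on the nose.
This file deliberately imports the bridge module HERE and not in the route file (route-repair
rev 1 removed that import from the route's cone).
-/

set_option linter.dupNamespace false -- `Summit.PneNP.PneNP.…`: summit = sub-problem (D-0017)

namespace Summit.PneNP.PneNP.Theorems

/-- **Item stmt-PneNP-18051** (`KarlinRubin.CliqueCircuitsOfNotPneNP`, support): `¬ PneNP`
implies polynomial-size `B₂`-circuits for `CLIQUE(n, t)`, for all large `n` and every `t ≤ n`.
Composition of `NP_subset_PPoly_of_not_pneNP` (`¬ PneNP → NP ⊆ P/poly`) with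
`exists_circuit_cliqueFn_of_NP_subset_PPoly` (`NP ⊆ P/poly →` small circuits for `cliqueFn`);
the route's inline clique test is `cliqueFn n t` by `rfl`. [Karp1972, §4; AroraBarak2009, Thm. 6.6] -/
theorem cliqueCircuitsOfNotPneNP_proof :
    Summit.PneNP.PneNP.Theses.KarlinRubin.CliqueCircuitsOfNotPneNP := by
  unfold Summit.PneNP.PneNP.Theses.KarlinRubin.CliqueCircuitsOfNotPneNP
  intro hne
  exact exists_circuit_cliqueFn_of_NP_subset_PPoly (NP_subset_PPoly_of_not_pneNP hne)

end Summit.PneNP.PneNP.Theorems
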